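import Mathlib
import Literature.AlgebraicGeometry.Resolution.AffineBlowupRegular
import Literature.AlgebraicGeometry.Resolution.AffineBlowupIntegral
import Literature.AlgebraicGeometry.Resolution.MvPolynomialKillVars

/-!
# `Bl_{(x_{0,i} : i)} 𝔸²ⁿ` is regular, integral, proper and birational (chain w45c, programme T, stretch)

(crux stmt-ResolutionOfSingularities-15640 `WildQuotients.WildQuotientResolution`, line `Sketch`,
programme «INSTANTIATE T1», stretch `𝔸²ⁿ/(J₂^{⊕n})` of `L/w45c/CHAIN.md` §5; [OURS · L1 W4.5c] —
NOT a statement of any manuscript.)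

The blow-up of `𝔸²ⁿ_k = Spec k[x_{0,i}, x_{1,i}]` in the coordinate subspace `V(x_{0,i} : i)` (the
fixed locus of `J₂^{⊕n}`, of codimension `n`) is a regular integral scheme, proper and birational
over `𝔸²ⁿ` (`n ≥ 1`): `affineBlowup.isRegular_of_isWeaklyRegular` (the `x_{0,i}` form a regular
sequence — `MvPolynomial.isWeaklyRegular_map_X` — with regular quotient `k[x_{1,i}]` —
`MvPolynomial.quotientSpanXEquiv`), `affineBlowup.isIntegral`, `affineBlowup.isProper`,
`affineBlowup.isBirational`. The case `n = 2` in coordinates `Fin 4` is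
`TwoBlocks.stub_twoBlocks_blowup_regular`.
-/

-- single-problem summit: the doubled namespace component `ResolutionOfSingularities` is forced
set_option linter.dupNamespace false

noncomputable section

open MvPolynomial AlgebraicGeometry CategoryTheory Literature.AlgebraicGeometry.Resolution

namespace Summit.ResolutionOfSingularities.ResolutionOfSingularities.Theorems.WildQuotientResolution.NBlocks

/-- The centre `(x_{0,i} : i)` as the span of the image of `{0} × Fin n` under `X`. [folklore] -/
theorem span_centre_eq_span_image (k : Type) [Field k] (n : ℕ) :
    Ideal.span (Set.range fun i : Fin n => (X (0, i) : MvPolynomial (Fin 2 × Fin n) k)) =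
      Ideal.span (X '' Set.range fun i : Fin n => ((0 : Fin 2), i)) := by
  rw [← Set.range_comp]
  rfl

/-- `k[x_{0,i}, x_{1,i}]/(x_{0,i} : i)` is a regular ring (it is the polynomial ring `k[x_{1,i}]`,
`MvPolynomial.quotientSpanXEquiv`). [folklore] -/
theorem isRegularRing_quotient_centre (k : Type) [Field k] (n : ℕ) :
    IsRegularRing (MvPolynomial (Fin 2 × Fin n) k ⧸
      Ideal.span (Set.range fun i : Fin n => (X (0, i) : MvPolynomial (Fin 2 × Fin n) k))) := by
  rw [span_centre_eq_span_image]
  exact IsRegularRing.of_ringEquiv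
    (Literature.AlgebraicGeometry.Resolution.MvPolynomial.quotientSpanXEquiv (R := k)
      (Set.range fun i : Fin n => ((0 : Fin 2), i))).toRingEquiv.symm

/-- The coordinates `x_{0,0}, …, x_{0,n-1}` form a weakly regular sequence on `k[x_{0,i}, x_{1,i}]`
(`MvPolynomial.isWeaklyRegular_map_X`). [folklore] -/
theorem isWeaklyRegular_centre (k : Type) [Field k] (n : ℕ) :
    RingTheory.Sequence.IsWeaklyRegular (MvPolynomial (Fin 2 × Fin n) k)
      (List.ofFn fun i : Fin n => (X (0, i) : MvPolynomial (Fin 2 × Fin n) k)) := by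
  have h := Literature.AlgebraicGeometry.Resolution.MvPolynomial.isWeaklyRegular_map_X (R := k)
    (List.ofFn fun i : Fin n => ((0 : Fin 2), i))
    (List.nodup_ofFn.mpr fun i j hij => by simpa using hij)
  rwa [List.map_ofFn] at h

/-- The centre is a non-zero ideal for `n ≥ 1`. [folklore] -/
theorem span_centre_ne_bot (k : Type) [Field k] (n : ℕ) (hn : 0 < n) :
    Ideal.span (Set.range fun i : Fin n => (X (0, i) : MvPolynomial (Fin 2 × Fin n) k)) ≠ ⊥ :=
  fun h => MvPolynomial.X_ne_zero ((0 : Fin 2), (⟨0, hn⟩ : Fin n))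
    ((Ideal.span_eq_bot.mp h) _ ⟨⟨0, hn⟩, rfl⟩)

/-- **`Bl_{(x_{0,i} : i)} 𝔸²ⁿ` is a regular integral scheme, proper and birational over `𝔸²ⁿ`**
(`n ≥ 1`). [cite: Liu2002, Thm. 8.1.19 (a)] [cite: StacksProject, Tag 02OS] -/
theorem nBlocks_blowup_regular (k : Type) [Field k] (n : ℕ) (hn : 0 < n) :
    Scheme.IsRegular (affineBlowup
      (Ideal.span (Set.range fun i : Fin n => (X (0, i) : MvPolynomial (Fin 2 × Fin n) k)))) ∧
    IsIntegral (affineBlowup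
      (Ideal.span (Set.range fun i : Fin n => (X (0, i) : MvPolynomial (Fin 2 × Fin n) k)))) ∧
    IsProper (affineBlowup.π
      (Ideal.span (Set.range fun i : Fin n => (X (0, i) : MvPolynomial (Fin 2 × Fin n) k)))) ∧
    IsBirational (affineBlowup.π
      (Ideal.span (Set.range fun i : Fin n => (X (0, i) : MvPolynomial (Fin 2 × Fin n) k)))) := by
  haveI := isRegularRing_quotient_centre k n
  exact ⟨affineBlowup.isRegular_of_isWeaklyRegular _ (isWeaklyRegular_centre k n),
    affineBlowup.isIntegral (span_centre_ne_bot k n hn), inferInstance,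
    affineBlowup.isBirational (span_centre_ne_bot k n hn)⟩

end Summit.ResolutionOfSingularities.ResolutionOfSingularities.Theorems.WildQuotientResolution.NBlocks

end
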